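import Literature.MathematicalPhysics.QuantumFieldTheory.Balaban1983to89.B9Thm31SiteCoerciveFlatBlockY
import Literature.MathematicalPhysics.QuantumFieldTheory.Balaban1983to89.Node00.OpsYGauge

/-!
# `Balaban1983to89.B9Thm31SiteCoerciveGaugeBlockY` — T. Bałaban, *Propagators for lattice gauge theories in a background field*, Commun. Math.
# Phys. **99** (1985) 389–434 [Balaban1985BackgroundPropagators] Thm 3.1 p. 397 ∕ Thm 3.11 p. 416 («Doing the gauge transformation we get U = e^{iηA}
# with A small»), (3.28)–(3.33) pp. 395–396, (3.23)–(3.24) pp. 394–395: THE GAUGE COMPARISON ON ONE BLOCK for def-Y's site operator `Δ′_a(U)` —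
# the block's share of (3.24)'s form at `U` versus the FLAT block form of the gauged section, with explicit errors in the two smallness letters
# «`U^u` is `ρ`-close to `1` on the block's bonds» and «the block transporters of `U^u` are `ρ′`-close to `1`» (file 2 of 3)

statement-level skeleton of published theorems with citation tags; proofs where landed; nothing here is a claim about the Yang–Mills mass gap

THE PRINT (verbatim).  p. 395, (3.31)–(3.33): *«Δ_{U^u} = R(u)Δ_U R(u⁻¹) … Q′_j(U^u) = R(u)Q′_j(U)R(u⁻¹) … G′(U^u) = R(u)G′(U)R(u⁻¹)»*; p. 416 (proof of
Thm 3.11): *«The proof can be reduced to a proof of positivity of the operators G_□ … Doing the gauge transformation we get U = e^{iηA} with A small …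
G_□(e^{iηA}) = G_□(1)(I − V(A)G_□(1))⁻¹. In [4] we have proved that the operator G_□(1) is positive»*; (3.35) p. 396: *«there exists a gauge
transformation u on □ such that U^u = e^{iηA}. and … |A| < O(1)Mα₀(Lʲη)⁻¹»*.

WHY THIS FILE (cell `pub-ymgap`, Track A node N06 [B9], width seat `pub-ymgap-dag-n06-w1`, OFFER-A file 2∕3).  File 1 (`B9Thm31SiteCoerciveFlatBlockY`)
is the flat block coercivity in the Hilbert–Schmidt currency.  dag-n06-j's `B9Thm311DeltaPrimePos.trIP_deltaPrimeAY_eq` writes (3.24)'s form at def-Y's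
letter `deltaPrimeAY i par U` as `Σ_μ‖∇_{U,μ}Φ‖² + Σ_{s∈𝔅} levC_s·HS(blkSumY i par U Φ s)`.  THIS FILE bounds ONE BLOCK's share of that form from
below by the flat block form of the GAUGED section `Ψ = R(u)Φ` (print's `R(u)`: `Node00.conjY (gSiteY i u)`), for ANY gauge function `u` that is a
contraction pair on the block and ANY transporter table `par` obeying the contour gauge law (`Node00.IsGaugeLawS`; def-Y's `parSY`, `parSymY` do):
the two error terms are controlled by the DISPLAYED smallness letters `ρ` (the gauged bond variables `U^u(b)` on the block's interior bonds) and `ρ′`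
(the gauged block transporters `U^u(Γ_{c_s,z})`, `z ∈ s`) — which (3.35) supplies at the scale of the block (file 3, with `ρ = O(Mα₀)L^{−j}`,
`ρ′ = O(Mα₀)`).  Combined with file 1 this gives the per-block coercivity `(½·min(2∕((n−1)n), levC_s·n^{d+1}) − 4(d+1)ρ² − 4·levC_s·n^{d+1}·ρ′²)·Σ_{z∈s}HS(Φ z)
≤ Σ_{bonds⊂s} HS((∇_UΦ)(b)) + levC_s·HS(blkSumY … s)`, `n = L^{j(s)}`.
PRIOR ART DECLARED: pub-balaban's NE9 chain runs the same comparison at ITS letters (`B9Thm311SitePrimeFormCoerciveBlockGauge`, `TSite` carriers, axial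
gauges) — nothing of it is restated or imported; the gauge-covariance identities used here are def-Y's (`Node00.OpsYGauge.cdS_gaugeY`, the law
`IsGaugeLawS`) and the HS bookkeeping is dag-n06-j's (`B9Ineq369CurvatureSmallAtLettersY`), all BY NAME.

WHAT IS PROVED (sorry-free; 0 `def`; [folklore] finite-dimensional algebra over the tree's letters; no inequality of the papers asserted).
* §1 carriers: `shiftY_rsrc_eq_rtgt` (an interior bond's target is the torus shift of its source — no wrap), `isBlockUnion_XB` (the torus box is a union
  of `L^j`-blocks, `j ≤ k`), `filter_rblk_eq_filter_blkOf` ∕ `filter_rbond_eq` (file 1's block fibres ARE the blocks `s ∈ 𝔅` of def-Y's carrier),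
  ★ `hs_block_coercive_blk` (file 1's flat coercivity restated on a block `s ∈ 𝔅`).
* §2 fibre: `hs_R_eq_of_contraction` (`HS(R(γ)X) = HS(X)` for a contraction pair), `hs_R_sub_self_le` (`HS(R(V)X − X) ≤ 4ρ²HS(X)` for `|V − 1| ≤ ρ`,
  `|V⁻¹| ≤ 1`), `hs_add_ge_half_sub`, `hs_sum_le_card_mul` (Cauchy–Schwarz).
* §3 ★★ `hs_cdS_ge_gauged` (per interior bond: `HS((∇_UΦ)(z,μ)) ≥ ½HS(Ψ(z+e_μ) − Ψ(z)) − 4ρ²HS(Ψ(z+e_μ))`, `Ψ = R(u)Φ`, via (3.31) `cdS_gaugeY`),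
  `sum_hs_rtgt_le` (each block site is the target of at most `d+1` interior bonds), ★★ `sum_hs_cdS_ge_gauged` (summed over the block's interior bonds).
* §4 ★★ `blkSumY_eq_R_sum_gauged` ((3.32) for the block sum: `blkSum(U, Φ) = R(u(c)⁻¹)·Σ_{z∈s} R(U^u(Γ_{c,z}))Ψ(z)`), ★★ `hs_blkSumY_ge_gauged`
  (`HS(blkSum) ≥ ½HS(Σ_{z∈s}Ψ z) − 4ρ′²|s|·Σ_{z∈s}HS(Ψ z)`).
* §5 ★★★ `block_form_ge_of_gauge` — THE PER-BLOCK COERCIVITY at `U` from the two smallness letters (statement above).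
HONEST SCOPE.  Elementary; (3.35) is NOT unpacked here (file 3) and nothing of [B9]'s estimates is asserted; NOT a node discharge, NOT summit progress;
count-neutral; one finite lattice at a time; nothing continuum ∕ OS ∕ mass gap ∕ Clay.
-/

noncomputable section

namespace Literature.MathematicalPhysics.QuantumFieldTheory.Balaban1983to89.B9Thm31SiteCoerciveGaugeBlockY

open Literature.MathematicalPhysics.QuantumFieldTheory.Balaban1983to89
open B9Thm311ReadingCoords B9Thm311DeltaPrimePos B9Ineq369CurvatureSmallAtLettersY B9Thm31SiteCoerciveFlatBlockY Node00
open B6KLevelCensusIndexV1 B6Geom246MultiLevelBox B6MultiLevelBoxOperator B6MultiLevelTorusOperator B9Eq39Adjoint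
open Literature.MathematicalPhysics.QuantumFieldTheory.Balaban1983to89.B4Reflection242 (boxDom blk mem_boxDom)
open Literature.MathematicalPhysics.QuantumFieldTheory.Balaban1983to89.B4BoxCov237 (uvec)
open Literature.MathematicalPhysics.QuantumFieldTheory.Balaban1983to89.B4Lower18 (IsBlockUnion RBond rsrc rtgt rblk boxDom_isBlockUnion)
open scoped Matrix Matrix.Norms.L2Operator

variable {d ℓ : ℕ} {hd : 1 ≤ d + 1} {hL : Odd (ℓ + 1) ∧ 1 < ℓ + 1} {b₀ b₁ : ℝ}

/-! ## §1 Carriers: interior bonds, block fibres, the flat coercivity on a block of `𝔅` -/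

section Carriers

variable (i : KIdx d ℓ hd hL b₀ b₁)

/-- an INTERIOR bond of the torus box (both ends in the box, no wrap-around): its target is the torus shift of its source.
[cite: Balaban1984PropagatorsII, (2.1) p.224, dictionary] -/
theorem shiftY_rsrc_eq_rtgt (k : RBond (toKT i).XB) : shiftY i k.1.2 (rsrc k) = rtgt k := by
  apply Subtype.ext
  show (tshift (toKT i).NB (unitVec k.1.2) (rsrc k)).1 = (rsrc k).1 + uvec k.1.2
  exact tshift_val_of_mem k.2

/-- the torus box `Π_μ[0, N₀_μ)` is a union of `L^j`-blocks for every `j ≤ k` (`N₀_μ = L^k·L·M_h·P_μ`). [cite: Balaban1984PropagatorsII, (2.1) p.224, dictionary] -/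
theorem isBlockUnion_XB {j : ℕ} (hj : j ≤ i.k) : IsBlockUnion ((ℓ + 1) ^ j) (toKT i).XB := by
  have h : (toKT i).XB = boxDom (fun μ => (ℓ + 1) ^ j * ((ℓ + 1) ^ (i.k - j) * ((ℓ + 1) * (i.Mh * i.P' μ)))) := by
    show boxDom (N0 ℓ i.Mh i.k i.P') = _
    congr 1
    funext μ
    show (ℓ + 1) ^ i.k * ((ℓ + 1) * (i.Mh * i.P' μ)) = _
    have hk : (ℓ + 1) ^ i.k = (ℓ + 1) ^ j * (ℓ + 1) ^ (i.k - j) := by rw [← pow_add, Nat.add_sub_cancel' hj]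
    rw [hk]; ring
  rw [h]
  exact boxDom_isBlockUnion (Nat.one_le_pow _ _ (Nat.succ_pos ℓ)) _

/-- the label of a block `s ∈ 𝔅` as a block of side `L^{j(s)}` of the torus box. [cite: Balaban1984PropagatorsII, (2.1) p.224, dictionary] -/
theorem blk_label_mem (s : BlkY i) : s.1.2 ∈ ((toKT i).XB).image (blk ((ℓ + 1) ^ s.1.1)) := by
  obtain ⟨z, hz⟩ := exists_blkOf_eq i.D.toDomains s
  exact Finset.mem_image.2 ⟨z.1, z.2, (blkOf_eq_iff_blk i.D.toDomains).1 hz⟩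

/-- file 1's block fibre over the label of `s` IS the block `s`. [cite: Balaban1984PropagatorsII, (2.1) p.224, dictionary] -/
theorem filter_rblk_eq_filter_blkOf (s : BlkY i) :
    Finset.univ.filter (fun z : SiteY i => rblk ((ℓ + 1) ^ s.1.1) (toKT i).XB z = ⟨s.1.2, blk_label_mem i s⟩)
      = Finset.univ.filter (fun z : SiteY i => blkOf i.D.toDomains z = s) := by
  refine Finset.filter_congr fun z _ => ?_
  rw [blkOf_eq_iff_blk, Subtype.ext_iff]
  rfl

/-- … and the same for the interior-bond fibres. [cite: Balaban1984PropagatorsII, (2.1) p.224, dictionary] -/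
theorem filter_rbond_eq (s : BlkY i) :
    Finset.univ.filter (fun k : RBond (toKT i).XB =>
        rblk ((ℓ + 1) ^ s.1.1) (toKT i).XB (rsrc k) = ⟨s.1.2, blk_label_mem i s⟩ ∧
          rblk ((ℓ + 1) ^ s.1.1) (toKT i).XB (rtgt k) = ⟨s.1.2, blk_label_mem i s⟩)
      = Finset.univ.filter (fun k : RBond (toKT i).XB => blkOf i.D.toDomains (rsrc k) = s ∧ blkOf i.D.toDomains (rtgt k) = s) := by
  refine Finset.filter_congr fun k _ => ?_
  rw [blkOf_eq_iff_blk, blkOf_eq_iff_blk, Subtype.ext_iff, Subtype.ext_iff]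
  rfl

/-- the side `n = L^{j(s)}` of a block of `𝔅` is at least `2` (`L ≥ 2`, `j ≥ 1`). [cite: Balaban1984PropagatorsII, (2.3)–(2.4) p.224, bookkeeping] -/
theorem two_le_side (s : BlkY i) : 2 ≤ (ℓ + 1) ^ s.1.1 := by
  have h1 : 1 ≤ s.1.1 := (scale_bounds i.D.toDomains s).1
  have hℓ : 4 ≤ ℓ := i.hℓ
  calc 2 ≤ ℓ + 1 := by omega
    _ = (ℓ + 1) ^ 1 := (pow_one _).symm
    _ ≤ (ℓ + 1) ^ s.1.1 := Nat.pow_le_pow_right (Nat.succ_pos ℓ) h1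

variable {N : ℕ}

/-- ★ FILE 1's FLAT BLOCK COERCIVITY ON A BLOCK `s ∈ 𝔅` of def-Y's carrier (`n = L^{j(s)}`): for `0 ≤ κ`,
`min(2∕((n−1)n), κ·n^{d+1})·Σ_{z∈s} HS(Ψ z) ≤ Σ_{bonds⊂s} HS(Ψ(tgt) − Ψ(src)) + κ·HS(Σ_{z∈s} Ψ z)`.
[folklore] [cite: Balaban1984PropagatorsII, p.225, (2.14); Balaban1985BackgroundPropagators, Thm 3.11 p.416 («G_□(1) is positive»)] -/
theorem hs_block_coercive_blk (s : BlkY i) (Ψ : SiteY i → Matrix (Fin N) (Fin N) ℂ) {κ : ℝ} (hκ : 0 ≤ κ) :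
    min (1 / (((((ℓ + 1) ^ s.1.1 : ℕ) : ℝ) - 1) * (((ℓ + 1) ^ s.1.1 : ℕ) : ℝ) / 2)) (κ * (((ℓ + 1) ^ s.1.1 : ℕ) : ℝ) ^ (d + 1)) *
        ∑ z ∈ Finset.univ.filter (fun z : SiteY i => blkOf i.D.toDomains z = s), ∑ a, ∑ c, ‖Ψ z a c‖ ^ 2
      ≤ ∑ k ∈ Finset.univ.filter (fun k : RBond (toKT i).XB => blkOf i.D.toDomains (rsrc k) = s ∧ blkOf i.D.toDomains (rtgt k) = s),
            ∑ a, ∑ c, ‖(Ψ (rtgt k) - Ψ (rsrc k)) a c‖ ^ 2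
        + κ * ∑ a, ∑ c, ‖(∑ z ∈ Finset.univ.filter (fun z : SiteY i => blkOf i.D.toDomains z = s), Ψ z) a c‖ ^ 2 := by
  have h := hs_block_coercive_side (two_le_side i s) (isBlockUnion_XB i (scale_bounds i.D.toDomains s).2) ⟨s.1.2, blk_label_mem i s⟩ Ψ hκ
  rw [filter_rblk_eq_filter_blkOf, filter_rbond_eq] at h
  exact h

end Carriers

/-! ## §2 Fibre lemmas: conjugation by contraction pairs, `R(V)X − X` for `V` near `1`, Cauchy–Schwarz -/

section Fibre

variable {N : ℕ}

/-- `HS(R(γ)X) = HS(X)` for a CONTRACTION PAIR `|γ|, |γ⁻¹| ≤ 1` (at the record: `γ` unitary). [cite: Balaban1985BackgroundPropagators, (3.31) p.395, (3.35) p.396, bookkeeping] -/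
theorem hs_R_eq_of_contraction {γ : (Matrix (Fin N) (Fin N) ℂ)ˣ}
    (hγ : ‖(γ : Matrix (Fin N) (Fin N) ℂ)‖ ≤ 1 ∧ ‖((γ⁻¹ : (Matrix (Fin N) (Fin N) ℂ)ˣ) : Matrix (Fin N) (Fin N) ℂ)‖ ≤ 1)
    (X : Matrix (Fin N) (Fin N) ℂ) : ∑ a, ∑ b, ‖R γ X a b‖ ^ 2 = ∑ a, ∑ b, ‖X a b‖ ^ 2 := by
  refine le_antisymm (hs_R_le hγ X) ?_
  have hγ' : ‖((γ⁻¹ : (Matrix (Fin N) (Fin N) ℂ)ˣ) : Matrix (Fin N) (Fin N) ℂ)‖ ≤ 1 ∧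
      ‖(((γ⁻¹)⁻¹ : (Matrix (Fin N) (Fin N) ℂ)ˣ) : Matrix (Fin N) (Fin N) ℂ)‖ ≤ 1 := by
    rw [inv_inv]; exact ⟨hγ.2, hγ.1⟩
  have h := hs_R_le hγ' (R γ X)
  rwa [R_inv_R] at h

/-- `HS(R(V)X − X) ≤ 4ρ²·HS(X)` when `|V − 1| ≤ ρ` and `|V⁻¹| ≤ 1`: `R(V)X − X = (V − 1)XV⁻¹ + X(V⁻¹ − 1)` and `|V⁻¹ − 1| = |V⁻¹(1 − V)| ≤ ρ`.
[cite: Balaban1985BackgroundPropagators, (3.35) p.396, Thm 3.11 p.416 («U = e^{iηA} with A small»), bookkeeping] -/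
theorem hs_R_sub_self_le {V : (Matrix (Fin N) (Fin N) ℂ)ˣ} {ρ : ℝ} (hV : ‖(V : Matrix (Fin N) (Fin N) ℂ) - 1‖ ≤ ρ)
    (hVi : ‖((V⁻¹ : (Matrix (Fin N) (Fin N) ℂ)ˣ) : Matrix (Fin N) (Fin N) ℂ)‖ ≤ 1) (X : Matrix (Fin N) (Fin N) ℂ) :
    ∑ a, ∑ b, ‖(R V X - X) a b‖ ^ 2 ≤ 4 * ρ ^ 2 * ∑ a, ∑ b, ‖X a b‖ ^ 2 := by
  have hρ : 0 ≤ ρ := le_trans (norm_nonneg _) hV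
  set Vm : Matrix (Fin N) (Fin N) ℂ := (V : Matrix (Fin N) (Fin N) ℂ) with hVm
  set Vi : Matrix (Fin N) (Fin N) ℂ := ((V⁻¹ : (Matrix (Fin N) (Fin N) ℂ)ˣ) : Matrix (Fin N) (Fin N) ℂ) with hVi'
  have hsplit : R V X - X = (Vm - 1) * X * Vi + X * (Vi - 1) := by
    have hmul : Vm * Vi = 1 := by rw [hVm, hVi', ← Units.val_mul, mul_inv_cancel, Units.val_one]
    rw [R_def]
    noncomm_ring
  have hVi1 : ‖Vi - 1‖ ≤ ρ := by
    have e : Vi - 1 = Vi * (1 - Vm) := by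
      have hmul : Vi * Vm = 1 := by rw [hVm, hVi', ← Units.val_mul, inv_mul_cancel, Units.val_one]
      rw [mul_sub, mul_one, hmul]
    rw [e]
    calc ‖Vi * (1 - Vm)‖ ≤ ‖Vi‖ * ‖1 - Vm‖ := norm_mul_le _ _
      _ ≤ 1 * ρ := by
          refine mul_le_mul hVi ?_ (norm_nonneg _) zero_le_one
          rw [norm_sub_rev]; exact hV
      _ = ρ := one_mul ρ
  have hX := hs_nonneg X
  have h1 : ∑ a, ∑ b, ‖((Vm - 1) * X * Vi) a b‖ ^ 2 ≤ ρ ^ 2 * ∑ a, ∑ b, ‖X a b‖ ^ 2 := by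
    calc ∑ a, ∑ b, ‖((Vm - 1) * X * Vi) a b‖ ^ 2 ≤ ‖Vi‖ ^ 2 * ∑ a, ∑ b, ‖((Vm - 1) * X) a b‖ ^ 2 := hs_mul_right_le _ _
      _ ≤ 1 * ∑ a, ∑ b, ‖((Vm - 1) * X) a b‖ ^ 2 := by
          refine mul_le_mul_of_nonneg_right ?_ (hs_nonneg _)
          nlinarith [norm_nonneg Vi]
      _ ≤ ‖Vm - 1‖ ^ 2 * ∑ a, ∑ b, ‖X a b‖ ^ 2 := by rw [one_mul]; exact hs_mul_left_le _ _
      _ ≤ ρ ^ 2 * ∑ a, ∑ b, ‖X a b‖ ^ 2 := by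
          refine mul_le_mul_of_nonneg_right ?_ hX
          exact pow_le_pow_left₀ (norm_nonneg _) hV 2
  have h2 : ∑ a, ∑ b, ‖(X * (Vi - 1)) a b‖ ^ 2 ≤ ρ ^ 2 * ∑ a, ∑ b, ‖X a b‖ ^ 2 := by
    calc ∑ a, ∑ b, ‖(X * (Vi - 1)) a b‖ ^ 2 ≤ ‖Vi - 1‖ ^ 2 * ∑ a, ∑ b, ‖X a b‖ ^ 2 := hs_mul_right_le _ _
      _ ≤ ρ ^ 2 * ∑ a, ∑ b, ‖X a b‖ ^ 2 := by
          refine mul_le_mul_of_nonneg_right ?_ hX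
          exact pow_le_pow_left₀ (norm_nonneg _) hVi1 2
  rw [hsplit]
  have h := hs_add_le ((Vm - 1) * X * Vi) (X * (Vi - 1))
  linarith

/-- `HS(A + E) ≥ ½HS(A) − HS(E)` (from `HS(A) = HS((A + E) − E) ≤ 2HS(A + E) + 2HS(E)`). [folklore] -/
private theorem hs_add_ge_half_sub (A E : Matrix (Fin N) (Fin N) ℂ) :
    (1 / 2 : ℝ) * (∑ a, ∑ b, ‖A a b‖ ^ 2) - ∑ a, ∑ b, ‖E a b‖ ^ 2 ≤ ∑ a, ∑ b, ‖(A + E) a b‖ ^ 2 := by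
  have h := hs_sub_le (A + E) E
  rw [add_sub_cancel_right] at h
  linarith

/-- CAUCHY–SCHWARZ for `HS` of a finite sum: `HS(Σ_{z∈B} E z) ≤ |B|·Σ_{z∈B} HS(E z)`. [folklore] -/
private theorem hs_sum_le_card_mul {ι : Type} (B : Finset ι) (E : ι → Matrix (Fin N) (Fin N) ℂ) :
    ∑ a, ∑ b, ‖(∑ z ∈ B, E z) a b‖ ^ 2 ≤ (B.card : ℝ) * ∑ z ∈ B, ∑ a, ∑ b, ‖E z a b‖ ^ 2 := by
  calc ∑ a, ∑ b, ‖(∑ z ∈ B, E z) a b‖ ^ 2 ≤ ∑ a, ∑ b, (∑ z ∈ B, ‖E z a b‖) ^ 2 := by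
        refine Finset.sum_le_sum fun a _ => Finset.sum_le_sum fun b _ => ?_
        rw [Matrix.sum_apply]
        exact pow_le_pow_left₀ (norm_nonneg _) (norm_sum_le _ _) 2
    _ ≤ ∑ a, ∑ b, ((B.card : ℝ) * ∑ z ∈ B, ‖E z a b‖ ^ 2) :=
        Finset.sum_le_sum fun a _ => Finset.sum_le_sum fun b _ => sq_sum_le_card_mul_sum_sq
    _ = (B.card : ℝ) * ∑ a, ∑ b, ∑ z ∈ B, ‖E z a b‖ ^ 2 := by simp only [Finset.mul_sum]
    _ = (B.card : ℝ) * ∑ z ∈ B, ∑ a, ∑ b, ‖E z a b‖ ^ 2 := by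
        congr 1
        rw [Finset.sum_congr rfl fun a _ => Finset.sum_comm, Finset.sum_comm]

end Fibre

/-! ## §3 The gradient terms on the block's interior bonds, in the cube gauge -/

section Gradient

variable (i : KIdx d ℓ hd hL b₀ b₁) {N : ℕ}
variable (g : GaugeY (Matrix (Fin N) (Fin N) ℂ) i) (U : CfgY (Matrix (Fin N) (Fin N) ℂ) i)

/-- ★★ ONE INTERIOR BOND in a gauge `u`: with `Ψ = R(u)Φ` and `V = U^u`, if `|V(b) − 1| ≤ ρ`, `|V(b)⁻¹| ≤ 1` and `u` is a contraction pair at the source,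
`HS((∇_{U,μ}Φ)(z)) ≥ ½·HS(Ψ(z + e_μ) − Ψ(z)) − 4ρ²·HS(Ψ(z + e_μ))` — (3.31) `∇_{U^u}R(u) = R(u)∇_U` plus `R(V)X − X` small.
[cite: Balaban1985BackgroundPropagators, (3.31) p.395, Thm 3.11 p.416] -/
theorem hs_cdS_ge_gauged {ρ : ℝ} (k : RBond (toKT i).XB)
    (hg : ‖(gSiteY i g (rsrc k) : Matrix (Fin N) (Fin N) ℂ)‖ ≤ 1 ∧ ‖(((gSiteY i g (rsrc k))⁻¹ : (Matrix (Fin N) (Fin N) ℂ)ˣ) : Matrix (Fin N) (Fin N) ℂ)‖ ≤ 1)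
    (hV : ‖(UboxY i (gaugeY i g U) k.1.2 (rsrc k) : Matrix (Fin N) (Fin N) ℂ) - 1‖ ≤ ρ)
    (hVi : ‖(((UboxY i (gaugeY i g U) k.1.2 (rsrc k))⁻¹ : (Matrix (Fin N) (Fin N) ℂ)ˣ) : Matrix (Fin N) (Fin N) ℂ)‖ ≤ 1)
    (Φ : SiteY i → Matrix (Fin N) (Fin N) ℂ) :
    (1 / 2 : ℝ) * (∑ a, ∑ b, ‖(conjY (gSiteY i g) Φ (rtgt k) - conjY (gSiteY i g) Φ (rsrc k)) a b‖ ^ 2)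
        - 4 * ρ ^ 2 * ∑ a, ∑ b, ‖conjY (gSiteY i g) Φ (rtgt k) a b‖ ^ 2
      ≤ ∑ a, ∑ b, ‖cdS i U k.1.2 Φ (rsrc k) a b‖ ^ 2 := by
  set Ψ := conjY (gSiteY i g) Φ with hΨ
  -- (3.31): the gauged derivative is the conjugate of the derivative
  have hcov : cdS i (gaugeY i g U) k.1.2 Ψ (rsrc k) = R (gSiteY i g (rsrc k)) (cdS i U k.1.2 Φ (rsrc k)) := cdS_gaugeY i g U k.1.2 Φ (rsrc k)
  have heq : ∑ a, ∑ b, ‖cdS i U k.1.2 Φ (rsrc k) a b‖ ^ 2 = ∑ a, ∑ b, ‖cdS i (gaugeY i g U) k.1.2 Ψ (rsrc k) a b‖ ^ 2 := by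
    rw [hcov, hs_R_eq_of_contraction hg]
  -- the gauged derivative: `R(V)Ψ(z′) − Ψ(z) = (Ψ(z′) − Ψ(z)) + (R(V)Ψ(z′) − Ψ(z′))`
  have hform : cdS i (gaugeY i g U) k.1.2 Ψ (rsrc k)
      = (Ψ (rtgt k) - Ψ (rsrc k)) + (R (UboxY i (gaugeY i g U) k.1.2 (rsrc k)) (Ψ (rtgt k)) - Ψ (rtgt k)) := by
    rw [cdS, B9Eq39Adjoint.covD, shiftY_rsrc_eq_rtgt]
    abel
  rw [heq, hform]
  have h1 := hs_add_ge_half_sub (Ψ (rtgt k) - Ψ (rsrc k)) (R (UboxY i (gaugeY i g U) k.1.2 (rsrc k)) (Ψ (rtgt k)) - Ψ (rtgt k))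
  have h2 := hs_R_sub_self_le hV hVi (Ψ (rtgt k))
  linarith

/-- each block site is the TARGET of at most `d + 1` interior bonds of the block: `Σ_{bonds⊂s} f(tgt) ≤ (d+1)·Σ_{z∈s} f(z)` for `f ≥ 0`. [folklore] -/
private theorem sum_rtgt_le (s : BlkY i) (f : SiteY i → ℝ) (hf : ∀ z, 0 ≤ f z) :
    ∑ k ∈ Finset.univ.filter (fun k : RBond (toKT i).XB => blkOf i.D.toDomains (rsrc k) = s ∧ blkOf i.D.toDomains (rtgt k) = s), f (rtgt k)
      ≤ ((d : ℝ) + 1) * ∑ z ∈ Finset.univ.filter (fun z : SiteY i => blkOf i.D.toDomains z = s), f z := by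
  have hmaps : ∀ k ∈ Finset.univ.filter (fun k : RBond (toKT i).XB => blkOf i.D.toDomains (rsrc k) = s ∧ blkOf i.D.toDomains (rtgt k) = s),
      rtgt k ∈ Finset.univ.filter (fun z : SiteY i => blkOf i.D.toDomains z = s) := by
    intro k hk
    rw [Finset.mem_filter] at hk ⊢
    exact ⟨Finset.mem_univ _, hk.2.2⟩
  rw [← Finset.sum_fiberwise_of_maps_to hmaps, Finset.mul_sum]
  refine Finset.sum_le_sum fun z _ => ?_
  -- on the fibre over `z` the summand is the constant `f z`, and the fibre has at most `d + 1` bonds (one per direction)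
  have hconst : ∀ k ∈ (Finset.univ.filter (fun k : RBond (toKT i).XB =>
        blkOf i.D.toDomains (rsrc k) = s ∧ blkOf i.D.toDomains (rtgt k) = s)).filter (fun k => rtgt k = z), f (rtgt k) = f z := by
    intro k hk
    rw [(Finset.mem_filter.1 hk).2]
  rw [Finset.sum_congr rfl hconst, Finset.sum_const, nsmul_eq_mul]
  refine mul_le_mul_of_nonneg_right ?_ (hf z)
  have hcard := Finset.card_le_card_of_injOn (fun k : RBond (toKT i).XB => k.1.2)
    (s := (Finset.univ.filter (fun k : RBond (toKT i).XB =>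
        blkOf i.D.toDomains (rsrc k) = s ∧ blkOf i.D.toDomains (rtgt k) = s)).filter (fun k => rtgt k = z))
    (t := (Finset.univ : Finset (Fin (d + 1)))) (fun _ _ => Finset.mem_coe.2 (Finset.mem_univ _)) ?_
  · rw [Finset.card_univ, Fintype.card_fin] at hcard
    exact_mod_cast hcard
  · intro k hk k' hk' hμ
    have hz : rtgt k = rtgt k' := by
      rw [(Finset.mem_filter.1 (Finset.mem_coe.1 hk)).2, (Finset.mem_filter.1 (Finset.mem_coe.1 hk')).2]
    have hμ' : k.1.2 = k'.1.2 := hμ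
    have hv : (rsrc k).1 = (rsrc k').1 := by
      have := congrArg Subtype.val hz
      change (rsrc k).1 + uvec k.1.2 = (rsrc k').1 + uvec k'.1.2 at this
      rw [hμ'] at this
      exact add_right_cancel this
    exact Subtype.ext (Prod.ext (Subtype.ext hv) hμ')

/-- ★★ THE GRADIENT TERMS OF ONE BLOCK in a gauge `u` (contraction pair on the block; `|U^u(b) − 1| ≤ ρ`, `|U^u(b)⁻¹| ≤ 1` on the block's interior bonds):
`Σ_{bonds⊂s} HS((∇_UΦ)(b)) ≥ ½·Σ_{bonds⊂s} HS(Ψ(tgt) − Ψ(src)) − 4(d+1)ρ²·Σ_{z∈s} HS(Ψ z)`, `Ψ = R(u)Φ`.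
[cite: Balaban1985BackgroundPropagators, (3.23) p.395, (3.31) p.395, Thm 3.11 p.416] -/
theorem sum_hs_cdS_ge_gauged {ρ : ℝ} (s : BlkY i)
    (hg : ∀ z : SiteY i, blkOf i.D.toDomains z = s →
      ‖(gSiteY i g z : Matrix (Fin N) (Fin N) ℂ)‖ ≤ 1 ∧ ‖(((gSiteY i g z)⁻¹ : (Matrix (Fin N) (Fin N) ℂ)ˣ) : Matrix (Fin N) (Fin N) ℂ)‖ ≤ 1)
    (hV : ∀ k : RBond (toKT i).XB, blkOf i.D.toDomains (rsrc k) = s → blkOf i.D.toDomains (rtgt k) = s →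
      ‖(UboxY i (gaugeY i g U) k.1.2 (rsrc k) : Matrix (Fin N) (Fin N) ℂ) - 1‖ ≤ ρ ∧
        ‖(((UboxY i (gaugeY i g U) k.1.2 (rsrc k))⁻¹ : (Matrix (Fin N) (Fin N) ℂ)ˣ) : Matrix (Fin N) (Fin N) ℂ)‖ ≤ 1)
    (Φ : SiteY i → Matrix (Fin N) (Fin N) ℂ) :
    (1 / 2 : ℝ) * ∑ k ∈ Finset.univ.filter (fun k : RBond (toKT i).XB => blkOf i.D.toDomains (rsrc k) = s ∧ blkOf i.D.toDomains (rtgt k) = s),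
          ∑ a, ∑ b, ‖(conjY (gSiteY i g) Φ (rtgt k) - conjY (gSiteY i g) Φ (rsrc k)) a b‖ ^ 2
        - 4 * ((d : ℝ) + 1) * ρ ^ 2 * ∑ z ∈ Finset.univ.filter (fun z : SiteY i => blkOf i.D.toDomains z = s),
            ∑ a, ∑ b, ‖conjY (gSiteY i g) Φ z a b‖ ^ 2
      ≤ ∑ k ∈ Finset.univ.filter (fun k : RBond (toKT i).XB => blkOf i.D.toDomains (rsrc k) = s ∧ blkOf i.D.toDomains (rtgt k) = s),
          ∑ a, ∑ b, ‖cdS i U k.1.2 Φ (rsrc k) a b‖ ^ 2 := by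
  set K := Finset.univ.filter (fun k : RBond (toKT i).XB => blkOf i.D.toDomains (rsrc k) = s ∧ blkOf i.D.toDomains (rtgt k) = s) with hK
  have hmem : ∀ {k}, k ∈ K → blkOf i.D.toDomains (rsrc k) = s ∧ blkOf i.D.toDomains (rtgt k) = s := fun {k} hk => by
    simpa [hK] using hk
  have hbond : ∀ k ∈ K, (1 / 2 : ℝ) * (∑ a, ∑ b, ‖(conjY (gSiteY i g) Φ (rtgt k) - conjY (gSiteY i g) Φ (rsrc k)) a b‖ ^ 2)
        - 4 * ρ ^ 2 * ∑ a, ∑ b, ‖conjY (gSiteY i g) Φ (rtgt k) a b‖ ^ 2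
      ≤ ∑ a, ∑ b, ‖cdS i U k.1.2 Φ (rsrc k) a b‖ ^ 2 := fun k hk =>
    hs_cdS_ge_gauged i g U k (hg _ (hmem hk).1) (hV k (hmem hk).1 (hmem hk).2).1 (hV k (hmem hk).1 (hmem hk).2).2 Φ
  have hsum := Finset.sum_le_sum hbond
  rw [Finset.sum_sub_distrib, ← Finset.mul_sum, ← Finset.mul_sum] at hsum
  have hcount := sum_rtgt_le i s (fun z => ∑ a, ∑ b, ‖conjY (gSiteY i g) Φ z a b‖ ^ 2) fun z => hs_nonneg _
  have hρ2 : 0 ≤ 4 * ρ ^ 2 := by positivity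
  have h3 : 4 * ρ ^ 2 * ∑ k ∈ K, ∑ a, ∑ b, ‖conjY (gSiteY i g) Φ (rtgt k) a b‖ ^ 2
      ≤ 4 * ((d : ℝ) + 1) * ρ ^ 2 * ∑ z ∈ Finset.univ.filter (fun z : SiteY i => blkOf i.D.toDomains z = s),
          ∑ a, ∑ b, ‖conjY (gSiteY i g) Φ z a b‖ ^ 2 := by
    have := mul_le_mul_of_nonneg_left hcount hρ2
    linarith
  linarith

end Gradient

/-! ## §4 The block sum in the cube gauge -/

section BlockSum

variable (i : KIdx d ℓ hd hL b₀ b₁) {N : ℕ}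
variable (g : GaugeY (Matrix (Fin N) (Fin N) ℂ) i) (U : CfgY (Matrix (Fin N) (Fin N) ℂ) i)
variable {par : SiteParY (Matrix (Fin N) (Fin N) ℂ) i} (hS : IsGaugeLawS i par)
include hS

/-- ★★ (3.32) FOR THE BLOCK SUM: with `Ψ = R(u)Φ`, `V = U^u` and `c` the corner of `s`,
`Σ_{z∈s} R(U(Γ_{c,z}))Φ(z) = R(u(c)⁻¹)·Σ_{z∈s} R(V(Γ_{c,z}))Ψ(z)` (the contour gauge law `V(Γ_{c,z}) = u(c)U(Γ_{c,z})u(z)⁻¹`).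
[cite: Balaban1985BackgroundPropagators, (3.28) p.395, (3.32) p.395 («Q′_j(U^u) = R(u)Q′_j(U)R(u⁻¹)»)] -/
theorem blkSumY_eq_R_sum_gauged (Φ : SiteY i → Matrix (Fin N) (Fin N) ℂ) (s : BlkY i) :
    blkSumY i par U Φ s
      = R (gSiteY i g (blkCornerY i s))⁻¹
          (∑ z ∈ Finset.univ.filter (fun z : SiteY i => blkOf i.D.toDomains z = s),
            R (par (gaugeY i g U) (blkCornerY i s) z) (conjY (gSiteY i g) Φ z)) := by
  have hlin : ∀ (γ : (Matrix (Fin N) (Fin N) ℂ)ˣ) (f : SiteY i → Matrix (Fin N) (Fin N) ℂ) (B : Finset (SiteY i)),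
      R γ (∑ z ∈ B, f z) = ∑ z ∈ B, R γ (f z) := fun γ f B => map_sum (RL γ) f B
  rw [blkSumY, hlin]
  refine Finset.sum_congr rfl fun z _ => ?_
  show R (par U (blkCornerY i s) z) (Φ z) = R (gSiteY i g (blkCornerY i s))⁻¹ (R (par (gaugeY i g U) (blkCornerY i s) z) (R (gSiteY i g z) (Φ z)))
  rw [hS g U (blkCornerY i s) z]
  simp only [← B9Eq39Adjoint.R_mul]
  congr 1
  group

/-- ★★ THE BLOCK SUM in a gauge `u` (contraction pair on the block; the gauged block transporters `|V(Γ_{c,z}) − 1| ≤ ρ′`, `|V(Γ_{c,z})⁻¹| ≤ 1` on `s`):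
`HS(blkSumY … s) ≥ ½·HS(Σ_{z∈s} Ψ z) − 4ρ′²|s|·Σ_{z∈s} HS(Ψ z)`, `Ψ = R(u)Φ`, `|s| = n^{d+1}`.
[cite: Balaban1985BackgroundPropagators, (3.19) p.393, (3.32) p.395, Thm 3.11 p.416] -/
theorem hs_blkSumY_ge_gauged {ρ' : ℝ} (s : BlkY i)
    (hg : ∀ z : SiteY i, blkOf i.D.toDomains z = s →
      ‖(gSiteY i g z : Matrix (Fin N) (Fin N) ℂ)‖ ≤ 1 ∧ ‖(((gSiteY i g z)⁻¹ : (Matrix (Fin N) (Fin N) ℂ)ˣ) : Matrix (Fin N) (Fin N) ℂ)‖ ≤ 1)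
    (hP : ∀ z : SiteY i, blkOf i.D.toDomains z = s →
      ‖(par (gaugeY i g U) (blkCornerY i s) z : Matrix (Fin N) (Fin N) ℂ) - 1‖ ≤ ρ' ∧
        ‖(((par (gaugeY i g U) (blkCornerY i s) z)⁻¹ : (Matrix (Fin N) (Fin N) ℂ)ˣ) : Matrix (Fin N) (Fin N) ℂ)‖ ≤ 1)
    (Φ : SiteY i → Matrix (Fin N) (Fin N) ℂ) :
    (1 / 2 : ℝ) * ∑ a, ∑ b, ‖(∑ z ∈ Finset.univ.filter (fun z : SiteY i => blkOf i.D.toDomains z = s), conjY (gSiteY i g) Φ z) a b‖ ^ 2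
        - 4 * ρ' ^ 2 * (((ℓ + 1) ^ s.1.1 : ℕ) : ℝ) ^ (d + 1) *
            ∑ z ∈ Finset.univ.filter (fun z : SiteY i => blkOf i.D.toDomains z = s), ∑ a, ∑ b, ‖conjY (gSiteY i g) Φ z a b‖ ^ 2
      ≤ ∑ a, ∑ b, ‖blkSumY i par U Φ s a b‖ ^ 2 := by
  set B := Finset.univ.filter (fun z : SiteY i => blkOf i.D.toDomains z = s) with hB
  set Ψ := conjY (gSiteY i g) Φ with hΨ
  have hmem : ∀ {z}, z ∈ B → blkOf i.D.toDomains z = s := fun {z} hz => by simpa [hB] using hz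
  have hc : blkOf i.D.toDomains (blkCornerY i s) = s := blkOf_corner i.D.toDomains s
  -- the corner frame is a contraction pair: HS is invariant
  have hcg := hg (blkCornerY i s) hc
  have hcg' : ‖(((gSiteY i g (blkCornerY i s))⁻¹ : (Matrix (Fin N) (Fin N) ℂ)ˣ) : Matrix (Fin N) (Fin N) ℂ)‖ ≤ 1 ∧
      ‖((((gSiteY i g (blkCornerY i s))⁻¹)⁻¹ : (Matrix (Fin N) (Fin N) ℂ)ˣ) : Matrix (Fin N) (Fin N) ℂ)‖ ≤ 1 := by
    rw [inv_inv]; exact ⟨hcg.2, hcg.1⟩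
  have heq : ∑ a, ∑ b, ‖blkSumY i par U Φ s a b‖ ^ 2
      = ∑ a, ∑ b, ‖(∑ z ∈ B, R (par (gaugeY i g U) (blkCornerY i s) z) (Ψ z)) a b‖ ^ 2 := by
    rw [blkSumY_eq_R_sum_gauged i g U hS Φ s, hs_R_eq_of_contraction hcg']
  -- split `Σ R(P_z)Ψ z = Σ Ψ z + Σ (R(P_z)Ψ z − Ψ z)`
  have hsplit : ∑ z ∈ B, R (par (gaugeY i g U) (blkCornerY i s) z) (Ψ z)
      = (∑ z ∈ B, Ψ z) + ∑ z ∈ B, (R (par (gaugeY i g U) (blkCornerY i s) z) (Ψ z) - Ψ z) := by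
    rw [← Finset.sum_add_distrib]
    refine Finset.sum_congr rfl fun z _ => ?_
    abel
  rw [heq, hsplit]
  have h1 := hs_add_ge_half_sub (∑ z ∈ B, Ψ z) (∑ z ∈ B, (R (par (gaugeY i g U) (blkCornerY i s) z) (Ψ z) - Ψ z))
  have h2 := hs_sum_le_card_mul B (fun z => R (par (gaugeY i g U) (blkCornerY i s) z) (Ψ z) - Ψ z)
  have h3 : ∑ z ∈ B, ∑ a, ∑ b, ‖(R (par (gaugeY i g U) (blkCornerY i s) z) (Ψ z) - Ψ z) a b‖ ^ 2
      ≤ ∑ z ∈ B, 4 * ρ' ^ 2 * ∑ a, ∑ b, ‖Ψ z a b‖ ^ 2 :=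
    Finset.sum_le_sum fun z hz => hs_R_sub_self_le (hP z (hmem hz)).1 (hP z (hmem hz)).2 (Ψ z)
  rw [← Finset.mul_sum] at h3
  have hcard : (B.card : ℝ) = (((ℓ + 1) ^ s.1.1 : ℕ) : ℝ) ^ (d + 1) := by
    rw [hB, ← filter_rblk_eq_filter_blkOf i s,
      B4Lower18.card_filter_rblk (le_trans one_le_two (two_le_side i s)) (isBlockUnion_XB i (scale_bounds i.D.toDomains s).2)]
    push_cast; ring
  have hcard0 : 0 ≤ (B.card : ℝ) := Nat.cast_nonneg _
  have h4 : (B.card : ℝ) * ∑ z ∈ B, ∑ a, ∑ b, ‖(R (par (gaugeY i g U) (blkCornerY i s) z) (Ψ z) - Ψ z) a b‖ ^ 2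
      ≤ (B.card : ℝ) * (4 * ρ' ^ 2 * ∑ z ∈ B, ∑ a, ∑ b, ‖Ψ z a b‖ ^ 2) := mul_le_mul_of_nonneg_left h3 hcard0
  rw [hcard] at h2 h4
  linarith

end BlockSum

/-! ## §5 The per-block coercivity at `U` from the two smallness letters -/

section Block

variable (i : KIdx d ℓ hd hL b₀ b₁) {N : ℕ}
variable (g : GaugeY (Matrix (Fin N) (Fin N) ℂ) i) (U : CfgY (Matrix (Fin N) (Fin N) ℂ) i)
variable {par : SiteParY (Matrix (Fin N) (Fin N) ℂ) i} (hS : IsGaugeLawS i par)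
include hS

/-- ★★★ **THE PER-BLOCK COERCIVITY OF (3.24)'s FORM AT A CURVED BACKGROUND**, from the two smallness letters of a gauge `u` on the block `s ∈ 𝔅` (side
`n = L^{j(s)}`): `u` a contraction pair on `s`; `|U^u(b) − 1| ≤ ρ`, `|U^u(b)⁻¹| ≤ 1` on the interior bonds of `s`; `|U^u(Γ_{c_s,z}) − 1| ≤ ρ′`,
`|U^u(Γ_{c_s,z})⁻¹| ≤ 1` for `z ∈ s`; `κ ≥ 0`.  Then
`(½·min(2∕((n−1)n), κn^{d+1}) − 4(d+1)ρ² − 4κn^{d+1}ρ′²)·Σ_{z∈s} HS(Φ z) ≤ Σ_{bonds⊂s} HS((∇_UΦ)(b)) + κ·HS(blkSumY i par U Φ s)` — print's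
«G_□(e^{iηA}) … G_□(1) is positive» as a one-block form bound at def-Y's letters. [cite: Balaban1985BackgroundPropagators, Thm 3.11 p.416, (3.24) p.394, (3.31)–(3.32) p.395; Balaban1984PropagatorsII, (2.14) p.225] -/
theorem block_form_ge_of_gauge {ρ ρ' κ : ℝ} (hκ : 0 ≤ κ) (s : BlkY i)
    (hg : ∀ z : SiteY i, blkOf i.D.toDomains z = s →
      ‖(gSiteY i g z : Matrix (Fin N) (Fin N) ℂ)‖ ≤ 1 ∧ ‖(((gSiteY i g z)⁻¹ : (Matrix (Fin N) (Fin N) ℂ)ˣ) : Matrix (Fin N) (Fin N) ℂ)‖ ≤ 1)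
    (hV : ∀ k : RBond (toKT i).XB, blkOf i.D.toDomains (rsrc k) = s → blkOf i.D.toDomains (rtgt k) = s →
      ‖(UboxY i (gaugeY i g U) k.1.2 (rsrc k) : Matrix (Fin N) (Fin N) ℂ) - 1‖ ≤ ρ ∧
        ‖(((UboxY i (gaugeY i g U) k.1.2 (rsrc k))⁻¹ : (Matrix (Fin N) (Fin N) ℂ)ˣ) : Matrix (Fin N) (Fin N) ℂ)‖ ≤ 1)
    (hP : ∀ z : SiteY i, blkOf i.D.toDomains z = s →
      ‖(par (gaugeY i g U) (blkCornerY i s) z : Matrix (Fin N) (Fin N) ℂ) - 1‖ ≤ ρ' ∧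
        ‖(((par (gaugeY i g U) (blkCornerY i s) z)⁻¹ : (Matrix (Fin N) (Fin N) ℂ)ˣ) : Matrix (Fin N) (Fin N) ℂ)‖ ≤ 1)
    (Φ : SiteY i → Matrix (Fin N) (Fin N) ℂ) :
    ((1 / 2 : ℝ) * min (1 / (((((ℓ + 1) ^ s.1.1 : ℕ) : ℝ) - 1) * (((ℓ + 1) ^ s.1.1 : ℕ) : ℝ) / 2)) (κ * (((ℓ + 1) ^ s.1.1 : ℕ) : ℝ) ^ (d + 1))
        - 4 * ((d : ℝ) + 1) * ρ ^ 2 - 4 * κ * (((ℓ + 1) ^ s.1.1 : ℕ) : ℝ) ^ (d + 1) * ρ' ^ 2)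
        * ∑ z ∈ Finset.univ.filter (fun z : SiteY i => blkOf i.D.toDomains z = s), ∑ a, ∑ b, ‖Φ z a b‖ ^ 2
      ≤ ∑ k ∈ Finset.univ.filter (fun k : RBond (toKT i).XB => blkOf i.D.toDomains (rsrc k) = s ∧ blkOf i.D.toDomains (rtgt k) = s),
            ∑ a, ∑ b, ‖cdS i U k.1.2 Φ (rsrc k) a b‖ ^ 2
        + κ * ∑ a, ∑ b, ‖blkSumY i par U Φ s a b‖ ^ 2 := by
  have hmem : ∀ {z}, z ∈ Finset.univ.filter (fun z : SiteY i => blkOf i.D.toDomains z = s) → blkOf i.D.toDomains z = s :=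
    fun {z} hz => by simpa using hz
  -- `HS` is gauge invariant site by site on the block
  have hm : ∑ z ∈ Finset.univ.filter (fun z : SiteY i => blkOf i.D.toDomains z = s), ∑ a, ∑ b, ‖conjY (gSiteY i g) Φ z a b‖ ^ 2
      = ∑ z ∈ Finset.univ.filter (fun z : SiteY i => blkOf i.D.toDomains z = s), ∑ a, ∑ b, ‖Φ z a b‖ ^ 2 :=
    Finset.sum_congr rfl fun z hz => hs_R_eq_of_contraction (hg z (hmem hz)) (Φ z)
  have hgrad := sum_hs_cdS_ge_gauged i g U s hg hV Φ
  have hblk := hs_blkSumY_ge_gauged i g U hS s hg hP Φ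
  have hflat := hs_block_coercive_blk i s (conjY (gSiteY i g) Φ) hκ
  rw [hm] at hgrad hblk hflat
  have hblk' := mul_le_mul_of_nonneg_left hblk hκ
  have hV0 : (0 : ℝ) ≤ (((ℓ + 1) ^ s.1.1 : ℕ) : ℝ) ^ (d + 1) := by positivity
  have hmin0 : 0 ≤ min (1 / (((((ℓ + 1) ^ s.1.1 : ℕ) : ℝ) - 1) * (((ℓ + 1) ^ s.1.1 : ℕ) : ℝ) / 2)) (κ * (((ℓ + 1) ^ s.1.1 : ℕ) : ℝ) ^ (d + 1)) := by
    refine le_min ?_ (mul_nonneg hκ hV0)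
    have h2 := two_le_side i s
    have hn : (2 : ℝ) ≤ (((ℓ + 1) ^ s.1.1 : ℕ) : ℝ) := by exact_mod_cast h2
    have : 0 < ((((ℓ + 1) ^ s.1.1 : ℕ) : ℝ) - 1) * (((ℓ + 1) ^ s.1.1 : ℕ) : ℝ) / 2 := by nlinarith
    positivity
  nlinarith [hgrad, hblk', hflat, hmin0, hκ, hs_nonneg (blkSumY i par U Φ s), sq_nonneg ρ, sq_nonneg ρ',
    Finset.sum_nonneg (fun z (_ : z ∈ Finset.univ.filter (fun z : SiteY i => blkOf i.D.toDomains z = s)) => hs_nonneg (Φ z))]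

end Block

end Literature.MathematicalPhysics.QuantumFieldTheory.Balaban1983to89.B9Thm31SiteCoerciveGaugeBlockY
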